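import Summits.MatrixMultiplication.MatrixMultiplication.Theorems.AbelianSTPPCensusShapeCertVPDefs
import Summits.MatrixMultiplication.MatrixMultiplication.Theorems.AbelianSTPPCensusShapeCertSemantics

/-!
# Abelian STPP census — soundness of `ShapeCertVP` (part 1: semantics of rule U11-G in credit form)

Cell mm-stpp, route `AbelianSTPPCensusVP`, crux `ShapeExclusionVP337` (stmt-MatrixMultiplication-19191); seat mm-stpp-theory.
The checker and its semantic vocabulary (`AdmG`, `gsumV`, the triple-level fields) are defined in
`…Theorems.AbelianSTPPCensusShapeCertVPDefs`; this file proves: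
* the field equations of `shV` and the letter-form identities (`vol = mid · xz`, …);
* HEREDITY of rule U11-G in credit form (`AdmG.mono`: the floor side is monotone and each removed member returns at
  most its credit, `crT ≤ t·uu`);
* the weight inequalities behind the Grynkiewicz continuation bound: `whT + crT ≤ t·uu` (the form-independent weight is
  below the weight of every form) and `2t + 1 ≤ whT` (every member costs at least `2t + 1`).
The vM part of admissibility is `ShapeCert.AdmM` (seat eng-2), reused as is.
-/

set_option linter.dupNamespace false -- `MatrixMultiplication.MatrixMultiplication` (summit = problem, D-0017)
set_option autoImplicit false

namespace Summit.MatrixMultiplication.MatrixMultiplication.Theorems.ShapeCertVP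

open ShapeCert Multiset

section forms
/-! ### Letter forms on triples -/

/-- the volume factors through the middle letter -/
theorem vol_eq_mid_mul_xz (r : ℕ) (x : ℕ × ℕ × ℕ) : vol x = midT r x * xzT r x := by
  unfold vol
  match r with
  | 0 => simp only [midT, xzT, pca]; ring
  | 1 => simp only [midT, xzT, pbc]; ring
  | _ + 2 => simp only [midT, xzT, pab]; ring

/-- the other-letters product is a pair product -/
theorem xzT_le_uu (r : ℕ) (x : ℕ × ℕ × ℕ) : xzT r x ≤ uu x := by
  unfold uu
  match r with
  | 0 => simp only [xzT]; omega
  | 1 => simp only [xzT]; omega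
  | _ + 2 => simp only [xzT]; omega

/-- the other-letters product is at most the largest pair product -/
theorem xzT_le_mpp3 (r : ℕ) (x : ℕ × ℕ × ℕ) : xzT r x ≤ mpp3 x := by
  unfold mpp3
  match r with
  | 0 => simp only [xzT]; omega
  | 1 => simp only [xzT]; omega
  | _ + 2 => simp only [xzT]; omega

/-- the smallest side is at most the middle letter -/
theorem mn3_le_midT (r : ℕ) (x : ℕ × ℕ × ℕ) : mn3 x ≤ midT r x := by
  unfold mn3
  match r with
  | 0 => simp only [midT]; omega
  | 1 => simp only [midT]; omega
  | _ + 2 => simp only [midT]; omega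

/-- **a removed member returns at most its credit**: `cr_t(x) ≤ t·uu(x)` (`t ≥ 1`) -/
theorem crT_le (r t : ℕ) (x : ℕ × ℕ × ℕ) : crT r t x ≤ t * uu x := by
  unfold crT
  have hxz := xzT_le_uu r x
  split_ifs with h
  · rw [vol_eq_mid_mul_xz r]
    exact Nat.mul_le_mul (le_of_lt h) hxz
  · exact Nat.mul_le_mul_left _ hxz

/-- the subtracted part of the form-independent weight dominates every credit -/
theorem crT_le_sub (r t : ℕ) (x : ℕ × ℕ × ℕ) :
    crT r t x ≤ (if mn3 x < t then vol x else t * mpp3 x) := by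
  unfold crT
  by_cases hm : midT r x < t
  · rw [if_pos hm, if_pos (lt_of_le_of_lt (mn3_le_midT r x) hm)]
  · rw [if_neg hm]
    split_ifs with h
    · rw [vol_eq_mid_mul_xz r]; exact Nat.mul_le_mul_right _ (not_lt.mp hm)
    · exact Nat.mul_le_mul_left _ (xzT_le_mpp3 r x)

/-- the subtracted part of the weight is at most `t·uu` -/
theorem sub_le_tuu (t : ℕ) (x : ℕ × ℕ × ℕ) :
    (if mn3 x < t then vol x else t * mpp3 x) ≤ t * uu x := by
  have hm : mpp3 x ≤ uu x := by unfold mpp3 uu; omega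
  split_ifs with h
  · -- `vol = b · ca` (form B) and `b = mid₀`; if `mn3 < t` use the credit bound of the form whose middle letter is minimal
    have : ∃ r, midT r x = mn3 x := by
      unfold mn3
      rcases le_total x.1 (min x.2.1 x.2.2) with h1 | h1
      · exact ⟨1, by simp [midT, min_eq_left h1]⟩
      · rcases le_total x.2.1 x.2.2 with h2 | h2
        · exact ⟨0, by simp [midT]; omega⟩
        · exact ⟨2, by simp [midT]; omega⟩
    obtain ⟨r, hr⟩ := this
    have hc := crT_le r t x
    unfold crT at hc; rw [hr, if_pos h] at hc; exact hc
  · exact Nat.mul_le_mul_left _ hm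

/-- **the form-independent weight is below the weight of every form**: `ŵ_t + cr_t ≤ t·uu` -/
theorem whT_add_crT_le (r t : ℕ) (x : ℕ × ℕ × ℕ) : whT x t + crT r t x ≤ t * uu x := by
  have h1 := crT_le_sub r t x
  have h2 := sub_le_tuu t x
  unfold whT; omega

/-- the volume of a triple with a side below `t` is at most `(t − 1)·(largest pair product)` -/
theorem vol_le_of_mn3_lt {t : ℕ} (x : ℕ × ℕ × ℕ) (h : mn3 x < t) : vol x ≤ (t - 1) * mpp3 x := by
  unfold mn3 at h; unfold vol mpp3
  have e1 : x.1 * x.2.1 * x.2.2 = x.1 * pbc x := by unfold pbc; ring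
  have e2 : x.1 * x.2.1 * x.2.2 = x.2.1 * pca x := by unfold pca; ring
  have e3 : x.1 * x.2.1 * x.2.2 = x.2.2 * pab x := by unfold pab; ring
  rcases Nat.lt_or_ge x.1 t with h1 | h1
  · rw [e1]; exact (Nat.mul_le_mul_right _ (by omega)).trans (Nat.mul_le_mul_left _ (by omega))
  rcases Nat.lt_or_ge x.2.1 t with h2 | h2
  · rw [e2]; exact (Nat.mul_le_mul_right _ (by omega)).trans (Nat.mul_le_mul_left _ (by omega))
  have h3 : x.2.2 < t := by omega
  rw [e3]; exact (Nat.mul_le_mul_right _ (by omega)).trans (Nat.mul_le_mul_left _ (by unfold pab; omega))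

/-- **every member costs at least `2t + 1`** (positive sides, `t ≥ 2`) -/
theorem whT_ge {t : ℕ} (ht : 2 ≤ t) {x : ℕ × ℕ × ℕ} (h1 : 1 ≤ x.1) (h2 : 1 ≤ x.2.1) (h3 : 1 ≤ x.2.2) :
    2 * t + 1 ≤ whT x t := by
  have pa : 1 ≤ pab x := by unfold pab; exact Nat.mul_pos h1 h2
  have pb : 1 ≤ pbc x := by unfold pbc; exact Nat.mul_pos h2 h3
  have pc : 1 ≤ pca x := by unfold pca; exact Nat.mul_pos h3 h1
  have hum : mpp3 x + 2 ≤ uu x := by unfold mpp3 uu; omega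
  have hmp : 1 ≤ mpp3 x := by unfold mpp3; omega
  unfold whT
  split_ifs with hm
  · have hv := vol_le_of_mn3_lt x hm
    have e : (t - 1) * mpp3 x + mpp3 x = t * mpp3 x := by
      obtain ⟨s, rfl⟩ := Nat.exists_eq_add_of_le (show 1 ≤ t by omega)
      simp [Nat.add_mul, Nat.add_comm]
    have : t * (mpp3 x + 2) ≤ t * uu x := Nat.mul_le_mul_left _ hum
    have : t * (mpp3 x + 2) = t * mpp3 x + 2 * t := by ring
    omega
  · -- all sides `≥ t`: the two smaller pair products are `≥ t²` each
    rw [not_lt] at hm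
    unfold mn3 at hm
    have a1 : t ≤ x.1 := by omega
    have a2 : t ≤ x.2.1 := by omega
    have a3 : t ≤ x.2.2 := by omega
    have q1 : t * t ≤ pab x := by unfold pab; exact Nat.mul_le_mul a1 a2
    have q2 : t * t ≤ pbc x := by unfold pbc; exact Nat.mul_le_mul a2 a3
    have q3 : t * t ≤ pca x := by unfold pca; exact Nat.mul_le_mul a3 a1
    have hu : mpp3 x + 2 * (t * t) ≤ uu x := by unfold mpp3 uu; omega
    have : t * (mpp3 x + 2 * (t * t)) ≤ t * uu x := Nat.mul_le_mul_left _ hu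
    have e : t * (mpp3 x + 2 * (t * t)) = t * mpp3 x + 2 * (t * (t * t)) := by ring
    have : 2 * t + 1 ≤ 2 * (t * (t * t)) := by nlinarith
    omega

end forms

section admG
/-! ### Rule U11-G on multisets, credit form -/

/-- **Heredity of rule U11-G (credit form)**: it passes to sub-multisets. -/
theorem AdmG.mono {M : ℕ} {F G : Multiset (ℕ × ℕ × ℕ)} (h : AdmG M G) (hF : F ≤ G) : AdmG M F := by
  intro r t h3 hp1 hp2 hfib
  have hG := h r t h3 ((hp1.trans (sum_map_le_of_le hF _))) (hp2.trans (sum_map_le_of_le hF _))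
    (hfib.trans (sum_map_le_of_le hF _))
  rw [sum_map_split hF uu, sum_map_split hF (crT r t)] at hG
  have hcr : ((G - F).map (crT r t)).sum ≤ t * ((G - F).map uu).sum := by
    rw [← Multiset.sum_map_mul_left]
    exact Multiset.sum_map_le_sum_map _ _ fun x _ => crT_le r t x
  have e : t * ((F.map uu).sum + ((G - F).map uu).sum) = t * (F.map uu).sum + t * ((G - F).map uu).sum := by ring
  omega

end admG

section fields
/-! ### Fields of the record of a triple -/
variable (M : ℕ) (x : ℕ × ℕ × ℕ)

/-- the record of a triple has that triple -/
@[simp] theorem shV_tr : (shV M x).tr = x := by rcases x with ⟨a, b, c⟩; rfl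
/-- field `a` -/
@[simp] theorem shV_a : (shV M x).a = x.1 := rfl
/-- field `b` -/
@[simp] theorem shV_b : (shV M x).b = x.2.1 := rfl
/-- field `c` -/
@[simp] theorem shV_c : (shV M x).c = x.2.2 := rfl
/-- field `V` -/
@[simp] theorem shV_V : (shV M x).V = vol x := rfl
/-- field `ab` -/
@[simp] theorem shV_ab : (shV M x).ab = pab x := rfl
/-- field `bc` -/
@[simp] theorem shV_bc : (shV M x).bc = pbc x := rfl
/-- field `ca` -/
@[simp] theorem shV_ca : (shV M x).ca = pca x := rfl
/-- field `wA` -/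
@[simp] theorem shV_wA : (shV M x).wA = wa x := rfl
/-- field `wB` -/
@[simp] theorem shV_wB : (shV M x).wB = wb x := rfl
/-- field `wC` -/
@[simp] theorem shV_wC : (shV M x).wC = wc x := rfl
/-- field `g` -/
@[simp] theorem shV_g : (shV M x).g = gT x := rfl
/-- field `mpp` -/
@[simp] theorem shV_mpp : (shV M x).mpp = mpp3 x := rfl
/-- field `rho` -/
@[simp] theorem shV_rho : (shV M x).rho = rhoT x := rfl
/-- field `lev` -/
@[simp] theorem shV_lev : (shV M x).lev = levT x := rfl
/-- field `dab` -/
theorem shV_dab : (shV M x).dab = vol x - pab x + (if hasLCD (vol x) M x.2.2 then 0 else 1) := rfl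
/-- field `dbc` -/
theorem shV_dbc : (shV M x).dbc = vol x - pbc x + (if hasLCD (vol x) M x.1 then 0 else 1) := rfl
/-- field `dca` -/
theorem shV_dca : (shV M x).dca = vol x - pca x + (if hasLCD (vol x) M x.2.1 then 0 else 1) := rfl
/-- the weight of a record is the weight of its triple -/
@[simp] theorem wh_shV (t : ℕ) : wh t (shV M x) = whT x t := by
  unfold wh whT mn3; simp [uu]
/-- the ratio of a record is the ratio of its triple -/
@[simp] theorem qh_shV (t : ℕ) : qh t (shV M x) = qhT x t := by unfold qh qhT; simp
/-- middle letter of a record -/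
@[simp] theorem midOf_shV (r : ℕ) : midOf r (shV M x) = midT r x := by
  match r with
  | 0 => rfl
  | 1 => rfl
  | _ + 2 => rfl
/-- other-letters product of a record -/
@[simp] theorem xzOf_shV (r : ℕ) : xzOf r (shV M x) = xzT r x := by
  match r with
  | 0 => rfl
  | 1 => rfl
  | _ + 2 => rfl
/-- smaller other letter of a record -/
@[simp] theorem mnxzOf_shV (r : ℕ) : mnxzOf r (shV M x) = mnxzT r x := by
  match r with
  | 0 => rfl
  | 1 => rfl
  | _ + 2 => rfl
/-- the record does not depend on the order except in the tightness offsets: level -/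
theorem levT_eq_lev (M' : ℕ) : (shV M' x).lev = (shV M x).lev := rfl

end fields

end Summit.MatrixMultiplication.MatrixMultiplication.Theorems.ShapeCertVP
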